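import Summits.AtomisticToContinuum.Crystallization.Theorems.FrustratedLawDichotomyStrainedPatchHomEntrySemanticQuotExterior
import Summits.AtomisticToContinuum.Crystallization.Theorems.FrustratedLawDichotomyStrainedPatchHomEntrySemanticQuot

/-!
# The SIGN-FREE EXTERIOR LEAVES and the COLUMN FOLD for the orbit-quotient currency `semOKHQ` (27623 `(H) HomFloor (1/625)`, hcp half)

decomp-a2c lens-5 g88, FILE C2 of NODE 88's port (crux `AperiodicFrustratedLawGap`, stmt-AtomisticToContinuum-27623; imports the node `…HomEntrySemanticQuot`
and FILE C1 `…HomEntrySemanticQuotExterior`).  Items R3 (rest), R4 of the node memo's port recipe, DONE: the exterior machinery of record (v2 exterior slab leaf, v2 annulus leaf, tube-radius cell-backed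
leaf, cut-tree columns; all Booleans UNCHANGED) made available to the quotient currency.

* §1 (R3) `exteriorOK3_sound_farQ`: the tree's far-soundness of the tube-radius leaf with its two UNUSED sign binders `(_h0 : 0 ≤ ξ 0) (_h2 : 0 ≤ ξ 2)`
  deleted — proof VERBATIM (C1 does the same for `exteriorOK2_sound`, `annulusOK2_sound`).
* §2 `semOKHQ_of_exteriorOK2`, `semOKHQ_of_annulusOK2` (node §4b `semOKHQ_of_sound`); ★ `semOKHQ_of_cellBacked`: the cell-backed leaf backed by a
  `semOKHQ` fact of the adjacent cell (near configurations by the cell's quotient fact — positivity, `‖ξ‖ ≤ 1/4` and the sector are forwarded — far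
  ones by `exteriorOK3_sound_farQ`); `cellBackedAt_soundQ`.
* §3 (R4) the quotient column: `semOKHQ_cut`; the sign-free kernel prune leaf `kernLeafQ := sectorOut ∨ ballOut ∨ forceMenuC` (the force/exempt
  menu of record without its ball guard and without the signed quick table; `semOKHQ_of_kernLeafQ`); the five-kind menu `colLeaf5Q L` = listed `semOKHQ`
  cell ∣ `kernLeafQ` ∣ `exteriorOK2` ∣ `annulusOK2` ∣ cell-backed; ★★ `semOKHQ_of_cutOK_colLeaf5Q`; ★★★ `semOKHQ_root_of_colManifest5Q` (the quarter ROOT box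
  `rootCHQ/rootWHQ` of node §6 from a column manifest) and `homFloor_of_entryTree6RBKP4_colManifest5Q` (⟹ `HomFloor m` with the fcc tree of record).

Kernel definitions + soundness; complete proofs, no placeholders; standard axioms; additive (nothing landed is modified); only the tiny §4 smoke examples are kernel-evaluated.
`--supports stmt-AtomisticToContinuum-27623`.
-/

noncomputable section

open Set

namespace Summit.AtomisticToContinuum.Crystallization.Theorems.FrustratedLawDichotomyStrainedPatchHomExteriorRay

open scoped BigOperators RealInnerProductSpace
open Literature.Analysis.ValidatedNumerics.Numerics
open Summit.AtomisticToContinuum.Crystallization.Theorems.ChargedEnergyGapNegative (E3)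
open Summit.AtomisticToContinuum.Crystallization.Theorems.FrustratedLawDichotomySchurCut (effPot w₄₅ ω₄)
open Summit.AtomisticToContinuum.Crystallization.Theorems.FrustratedLawDichotomyAveragingRuleTightFree (TightNearCap BadNearCap)
open Summit.AtomisticToContinuum.Crystallization.Theorems.FrustratedLawDichotomyExemptAbsorption (ExemptNear)
open Summit.AtomisticToContinuum.Crystallization.Theorems.FrustratedLawDichotomyStrainedPatchHomSplit (ExRec latPt hexFrame hcpShift)
open Summit.AtomisticToContinuum.Crystallization.Theorems.FrustratedLawDichotomyStrainedPatchTaylorChord (segGd)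
open Summit.AtomisticToContinuum.Crystallization.Theorems.FrustratedLawDichotomyStrainedPatchHomCurvLeaf (nodup_filter_append toFinset_filter_append)
open Summit.AtomisticToContinuum.Crystallization.Theorems.FrustratedLawDichotomyStrainedPatchHomCurvLJ (curvCheckLJM ljLabelOK)
open Summit.AtomisticToContinuum.Crystallization.Theorems.FrustratedLawDichotomyStrainedPatchHomForceJacN (fjQ boxLabels11 boxLabels11_toFinset)
open Summit.AtomisticToContinuum.Crystallization.Theorems.FrustratedLawDichotomyStrainedPatchHomForceHcp (xiBallOK norm_le_quarter_of_xiBallOK)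
open Summit.AtomisticToContinuum.Crystallization.Theorems.FrustratedLawDichotomyStrainedPatchHomSlopeLJAffine (affShuf abs_affShuf_sub_le jw)
open Summit.AtomisticToContinuum.Crystallization.Theorems.FrustratedLawDichotomyStrainedPatchHomEntryLeafHT (htBU htRU htUniv htIn htK htROKU htBU_nodup
  htNaiOKA2 htGsA2 refForce_chunkA2_le jacOK jacOK_spec norm_le_seven_of_htIn lo_le_of_norm_le_seven six_le_norm_of_lo seven_lt_norm_of_not_mem_htUniv
  mem_boxLabels11_of_mem_htUniv mem_htUniv_of_mem_htBU htIn_of_mem_htBU mem_htBU_of_htIn)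
open Summit.AtomisticToContinuum.Crystallization.Theorems.FrustratedLawDichotomyStrainedPatchHomEntryLeafHT (semOKH semOKH_anti_box semOKH_forall semOKH_of_forall
  hcpCoord HcpLeafGoal inHcpBox_iff)
open Summit.AtomisticToContinuum.Crystallization.Theorems.FrustratedLawDichotomyStrainedPatchHomEntryGramHcp (rootCH rootWH)
open Summit.AtomisticToContinuum.Crystallization.Theorems.FrustratedLawDichotomyStrainedPatchHomForceCentredHcp (entryLeafOKHC)
open Summit.AtomisticToContinuum.Crystallization.Theorems.FrustratedLawDichotomyStrainedPatchHomLatticeBox (norm_apply_ge_of_near_one)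
open Summit.AtomisticToContinuum.Crystallization.Theorems.FrustratedLawDichotomyStrainedPatchHomCutTree (CutTree cutOK coveredAt coveredAt_sound
  semOKH_of_cutOK_leaves semOKH_of_entryLeafOKHC_level)
open Summit.AtomisticToContinuum.Crystallization.Theorems.FrustratedLawDichotomyStrainedPatchHomSplit (HomFloor)
open Summit.AtomisticToContinuum.Crystallization.Theorems.FrustratedLawDichotomyStrainedPatchHomCutTree (cutOK_sound boxContains_spec)
open Summit.AtomisticToContinuum.Crystallization.Theorems.FrustratedLawDichotomyStrainedPatchHomCertTree (CertTree treeOK)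
open Summit.AtomisticToContinuum.Crystallization.Theorems.FrustratedLawDichotomyStrainedPatchHomEntryLeafHT (entryLeafOK6RBKP4)
open Summit.AtomisticToContinuum.Crystallization.Theorems.FrustratedLawDichotomyStrainedPatchHomEntryGram (rootC rootW)
open Summit.AtomisticToContinuum.Crystallization.Theorems.FrustratedLawDichotomyStrainedPatchHomForceCentredHcp (forceMenuC)
open Summit.AtomisticToContinuum.Crystallization.Theorems.FrustratedLawDichotomyStrainedPatchHomForceCentredFinal (forceOutC0_sound)
open Summit.AtomisticToContinuum.Crystallization.Theorems.FrustratedLawDichotomyStrainedPatchHomEntrySemanticQuot (semOKHQ semOKHQ_of_forall semOKHQ_forall semOKHQ_anti_box semOKHQ_of_cut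
  semOKHQ_of_sound sectorOut ballOut semOKHQ_of_sectorOut semOKHQ_of_ballOut rootCHQ rootWHQ homFloor_of_entryTree6RBKP4_semOKHQ)

/-! ## §1. Far soundness of the tube-radius exterior leaf without the (unused) shuffle signs (R3) -/

/-- ★ **FAR SOUNDNESS of the tube-radius exterior leaf**: the `hver` conclusion at every level `μ` for every admissible `(U, ξ)` of the box lying at
`M`-distance at least `r/SC` from the cell's affine sheet point `affShuf J cC U`. [folklore chaining: v2's proof with the far hypothesis in place of the gap] -/
theorem exteriorOK3_sound_farQ {μ : ℤ} {J : Fin 3 → Fin 3 × Fin 3 → ℤ} {cC wC cH wH : Bx} {ch : List (Bx × Bx × (Fin 3 → Fin 3 → ℤ) × ℤ)} {lmin r : ℤ}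
    {c w : Bx} (h : exteriorOK3 J cC wC cH wH ch lmin r c w = true) (U : E3 →L[ℝ] E3) (ξ : E3)
    (_hsa : ∀ v v' : E3, ⟪U v, v'⟫ = ⟪v, U v'⟫) (hU : ‖U - 1‖ ≤ 1 / 4)
    (hbox : ∀ ab : Fin 3 × Fin 3, |(U (EuclideanSpace.single ab.2 (1 : ℝ))) ab.1 - (c (Sum.inl ab) : ℝ) / SC| ≤ (w (Sum.inl ab) : ℝ) / SC)
    (hξ : ∀ i : Fin 3, |ξ i - (c (Sum.inr i) : ℝ) / SC| ≤ (w (Sum.inr i) : ℝ) / SC)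
    (hfar : (r : ℝ) / SC ≤ ‖U (ξ - affShuf J cC U)‖) :
    (∀ (M : ℕ) (z : Fin M → E3) (cc : Fin M), Function.Injective z →
        Set.range z = {x : E3 | dist x (z cc) ≤ 133 / 10 ∧ ∃ a : Fin 3 → ℤ,
          x = z cc + latPt U hexFrame a ∨ x = z cc + latPt U hexFrame a + U (hcpShift + ξ)} →
        TightNearCap (9 / 5) (3 / 2) z cc ∨ ExemptNear (9 / 5) ExRec z cc ∨ BadNearCap (9 / 5) (3 / 2) z cc) ∨
      (μ : ℝ) / SC ≤ ∑ b ∈ (Fintype.piFinset fun _ : Fin 3 => Finset.Icc (-7 : ℤ) 7).filter (fun b => b ≠ 0), effPot w₄₅ ω₄ (3 / 400) ‖latPt U hexFrame b‖ +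
        ∑ b ∈ (Fintype.piFinset fun _ : Fin 3 => Finset.Icc (-7 : ℤ) 7), effPot w₄₅ ω₄ (3 / 400) ‖latPt U hexFrame b + U (hcpShift + ξ)‖ := by
  classical
  have hS : (0 : ℝ) < SC := SC_pos
  unfold exteriorOK3 extRest3 at h
  simp only [Bool.and_eq_true, decide_eq_true_eq] at h
  obtain ⟨⟨⟨⟨⟨⟨⟨⟨⟨⟨⟨⟨⟨⟨⟨hUC, hUH⟩, hball⟩, hjac⟩, hKlt⟩, hROK⟩, hNai⟩, hlen⟩, hfloors⟩, hgeom⟩, hCH⟩, hSH⟩, hr⟩, hlmin⟩, hdomZ⟩, hcurvs⟩ := h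
  -- entry boxes
  have hboxC := hbox_of_sameU hUC hbox
  have hboxH := hbox_of_sameU hUH hbox
  -- the reference: the cell's affine sheet point
  set ξ₀ : E3 := affShuf J cC U with hξ₀def
  have hξ₀C : ∀ m : Fin 3, |ξ₀ m - (cC (Sum.inr m) : ℝ) / SC| ≤ (wC (Sum.inr m) : ℝ) / SC := by
    intro m
    refine (abs_affShuf_sub_le (J := J) (w := wC) U hboxC m).trans ?_
    rw [div_le_div_iff_of_pos_right hS]
    exact_mod_cast jacOK_spec hjac m
  have hξ₀H := hxi_of_xiSub hCH hξ₀C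
  have hξH := hxi_of_xiSub hSH hξ
  have hn₀ : ‖ξ₀‖ ≤ 1 / 4 := norm_le_quarter_of_xiBallOK hball hξ₀H
  have hn : ‖ξ‖ ≤ 1 / 4 := norm_le_quarter_of_xiBallOK hball hξH
  -- label finsets from the HULL box (verbatim the cell proof's block at (cH, wH))
  set B : Finset (Fin 3 → ℤ) := (htBU cH wH).toFinset with hBdef
  set R : Finset (Fin 3 → ℤ) := (htRU cH wH).toFinset with hRdef
  have hB : B ⊆ Fintype.piFinset fun _ : Fin 3 => Finset.Icc (-11 : ℤ) 11 := by
    intro b hb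
    rw [← boxLabels11_toFinset]
    exact List.mem_toFinset.2 (mem_boxLabels11_of_mem_htUniv (mem_htUniv_of_mem_htBU (List.mem_toFinset.1 hb)))
  have hBin : ∀ bb ∈ B, ‖latPt U hexFrame bb + U (hcpShift + ξ)‖ ≤ 7 :=
    fun bb hbb => norm_le_seven_of_htIn U hboxH ξ hξH (htIn_of_mem_htBU (List.mem_toFinset.1 hbb))
  have hROK' : ∀ b ∈ htRU cH wH, 36 * (SC : ℤ) ≤ (fjQ cH wH b).lo := by
    intro b hb
    have := List.all_eq_true.1 hROK b hb
    simpa using this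
  have hR : ∀ bb ∈ (Fintype.piFinset fun _ : Fin 3 => Finset.Icc (-11 : ℤ) 11) \ B, ‖latPt U hexFrame bb + U (hcpShift + ξ)‖ ≤ 7 →
      bb ∈ R ∧ 6 ≤ ‖latPt U hexFrame bb + U (hcpShift + ξ)‖ := by
    intro bb hbb h7
    obtain ⟨hbox11, hnotB⟩ := Finset.mem_sdiff.1 hbb
    rw [← boxLabels11_toFinset] at hbox11
    have hbL : bb ∈ boxLabels11 := List.mem_toFinset.1 hbox11
    have hlo := lo_le_of_norm_le_seven U hboxH ξ hξH h7
    by_cases huniv : bb ∈ htUniv cH wH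
    swap
    · exact absurd h7 (not_le.2 (seven_lt_norm_of_not_mem_htUniv U hboxH hξH hKlt hbL huniv))
    by_cases hin : htIn cH wH bb = true
    · exact absurd (List.mem_toFinset.2 (mem_htBU_of_htIn huniv hin)) hnotB
    · have hmemR : bb ∈ htRU cH wH := by
        refine List.mem_filter.2 ⟨huniv, ?_⟩
        simp only [Bool.and_eq_true, Bool.not_eq_true', decide_eq_true_eq]
        exact ⟨by simpa using hin, hlo⟩
      exact ⟨List.mem_toFinset.2 hmemR, six_le_norm_of_lo U hboxH ξ hξH (hROK' bb hmemR)⟩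
  -- the slope bound at the reference over B (second-order centred chunk with L := htBU hull at the CELL box)
  have hf₀ := refForce_chunkA2_le (htBU_nodup cH wH) hNai U hU hboxC (by simpa [hξ₀def] using hn₀) ξ
  rw [← hBdef] at hf₀
  -- the chain
  set m : ℕ := ch.length with hmdef
  have hm : 0 < m := hlen
  simp only [extCurvAll, List.all_eq_true, List.mem_range] at hcurvs
  simp only [extFloorAll, List.all_eq_true, List.mem_range] at hfloors
  simp only [extGeomOK, List.all_eq_true, List.mem_range, Bool.and_eq_true, decide_eq_true_eq] at hgeom
  obtain ⟨⟨⟨hsameK, hC0⟩, hSlast⟩, hnestK⟩ := hgeom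
  have hLB : ∀ k, k < m → ((htBU cH wH).filter (fun b => ljLabelOK (chC ch k) (chW ch k) b) ++
      (htBU cH wH).filter (fun b => !ljLabelOK (chC ch k) (chW ch k) b)).toFinset = B :=
    fun k _ => by rw [hBdef]; exact toFinset_filter_append _ _
  have hnd : ∀ k, k < m → ((htBU cH wH).filter (fun b => ljLabelOK (chC ch k) (chW ch k) b) ++
      (htBU cH wH).filter (fun b => !ljLabelOK (chC ch k) (chW ch k) b)).Nodup :=
    fun k _ => nodup_filter_append (htBU_nodup cH wH) _
  have hchk : ∀ k, k < m → curvCheckLJM (chC ch k) (chW ch k) ((htBU cH wH).filter fun b => ljLabelOK (chC ch k) (chW ch k) b)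
      ((htBU cH wH).filter fun b => !ljLabelOK (chC ch k) (chW ch k) b) (chD ch k) (chL ch k) = true :=
    fun k hk => hcurvs k hk
  have hUbox : ∀ k, k < m → ∀ ab : Fin 3 × Fin 3,
      |(U (EuclideanSpace.single ab.2 (1 : ℝ))) ab.1 - (chC ch k (Sum.inl ab) : ℝ) / SC| ≤ (chW ch k (Sum.inl ab) : ℝ) / SC :=
    fun k hk => hbox_of_sameU (hsameK k hk) hbox
  have hnest : ∀ k, k + 1 < m → ∀ j : Fin 3, chC ch (k + 1) (Sum.inr j) - chW ch (k + 1) (Sum.inr j) ≤ chC ch k (Sum.inr j) - chW ch k (Sum.inr j) ∧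
      chC ch k (Sum.inr j) + chW ch k (Sum.inr j) ≤ chC ch (k + 1) (Sum.inr j) + chW ch (k + 1) (Sum.inr j) := by
    intro k hk j
    have h' := hnestK k (by omega) hk
    simp only [xiSub, decide_eq_true_eq] at h'
    exact h' j
  have h0 := hxi_of_xiSub hC0 hξ₀C
  have h1 := hxi_of_xiSub hSlast hξ
  -- the far hypothesis: hΔ and the domination
  have hrpos : (0 : ℝ) < (r : ℝ) / SC := div_pos (by exact_mod_cast hr) hS
  have hΔ : U (ξ - ξ₀) ≠ 0 := by
    intro h0
    rw [h0, norm_zero] at hfar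
    linarith
  have hℓ : ∀ k, k < m → ((lmin : ℝ) / SC) * ‖U (ξ - ξ₀)‖ ^ 2 ≤
      (chL ch k : ℝ) / SC * ‖U (ξ - ξ₀)‖ ^ 2 + ∑ i : Fin 3, ∑ j : Fin 3, (chD ch k i j : ℝ) / SC * ((U (ξ - ξ₀)) i * (U (ξ - ξ₀)) j) :=
    fun k hk => floorOK_sound (hfloors k hk) _
  -- the domination inequality from the integers
  have hRcard : (R.card : ℝ) ≤ ((htRU cH wH).length : ℝ) := by
    rw [hRdef]; exact_mod_cast List.toFinset_card_le _
  have hS7 : (6000 / 343 * (7 : ℝ)⁻¹ ^ 4 + 2880 / 49 * (7 : ℝ)⁻¹ ^ 5 + 10 / 7 * (7 : ℝ)⁻¹ ^ 6 + 2 * (7 : ℝ)⁻¹ ^ 7) = 8892 / 823543 := by norm_num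
  have h67 : ((6 : ℝ)⁻¹ ^ 7) = 1 / 279936 := by norm_num
  have hZ : (4 * (SC : ℝ) ^ 2 * 8892 * 279936 + 4 * (SC : ℝ) * (htGsA2 cC wC J (htBU cH wH) : ℝ) * 230539333248 +
      4 * (SC : ℝ) ^ 2 * ((htRU cH wH).length : ℝ) * 823543) < 4 * (lmin : ℝ) * (r : ℝ) * 230539333248 := by exact_mod_cast hdomZ
  have hlmin0 : (0 : ℝ) ≤ (lmin : ℝ) / SC := div_nonneg (by exact_mod_cast hlmin) hS.le
  have hK : (6000 / 343 * (7 : ℝ)⁻¹ ^ 4 + 2880 / 49 * (7 : ℝ)⁻¹ ^ 5 + 10 / 7 * (7 : ℝ)⁻¹ ^ 6 + 2 * (7 : ℝ)⁻¹ ^ 7) +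
      (htGsA2 cC wC J (htBU cH wH) : ℝ) / SC + R.card * (6 : ℝ)⁻¹ ^ 7 < (lmin : ℝ) / SC * ((r : ℝ) / SC) := by
    rw [hS7, h67]
    have hSC : (SC : ℝ) = 281474976710656 := by norm_num [SC]
    rw [hSC] at hZ ⊢
    have hR67 : (R.card : ℝ) * (1 / 279936) ≤ ((htRU cH wH).length : ℝ) * (1 / 279936) := mul_le_mul_of_nonneg_right hRcard (by norm_num)
    nlinarith [hZ, hR67]
  have hdom := hK.trans_le (mul_le_mul_of_nonneg_left hfar hlmin0)
  -- assemble
  exact hver_exterior_of_curvChecks_uniformFloor (μ := μ) hU hn₀ hn B R hB hBin hR hf₀ m hm (chC ch) (chW ch)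
    (fun k => (htBU cH wH).filter fun b => ljLabelOK (chC ch k) (chW ch k) b) (fun k => (htBU cH wH).filter fun b => !ljLabelOK (chC ch k) (chW ch k) b)
    (chD ch) (chL ch) hLB hnd hchk hUbox hnest h0 h1 hΔ hℓ hdom

/-! ## §2. The exterior leaves are `semOKHQ` facts -/

/-- ★ The v2 exterior slab leaf is a `semOKHQ` fact at every level. [formal bookkeeping] -/
theorem semOKHQ_of_exteriorOK2 {J : Fin 3 → Fin 3 × Fin 3 → ℤ} {cC wC cH wH : Bx} {ch : List (Bx × Bx × (Fin 3 → Fin 3 → ℤ) × ℤ)} {lmin g : ℤ}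
    {i : Fin 3} {c w : Bx} (h : exteriorOK2 J cC wC cH wH ch lmin g i c w = true) (μ : ℤ) : semOKHQ μ c w = true :=
  semOKHQ_of_sound (μ := μ) (fun c w => exteriorOK2 J cC wC cH wH ch lmin g i c w)
    (fun _ _ hv U ξ hsa _ hU _ hbox hξ _ _ => exteriorOK2_soundQ hv U ξ hsa hU hbox hξ) h

/-- ★ The v2 annulus leaf is a `semOKHQ` fact at every level. [formal bookkeeping] -/
theorem semOKHQ_of_annulusOK2 {J : Fin 3 → Fin 3 × Fin 3 → ℤ} {cC wC cH wH : Bx} {ch : List (Bx × Bx × (Fin 3 → Fin 3 → ℤ) × ℤ)} {ll : List ℤ} {den : ℤ}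
    {na nb : List ℤ} {g : ℤ} {i : Fin 3} {c w : Bx} (h : annulusOK2 J cC wC cH wH ch ll den na nb g i c w = true) (μ : ℤ) : semOKHQ μ c w = true :=
  semOKHQ_of_sound (μ := μ) (fun c w => annulusOK2 J cC wC cH wH ch ll den na nb g i c w)
    (fun _ _ hv U ξ hsa _ hU _ hbox hξ _ _ => annulusOK2_soundQ hv U ξ hsa hU hbox hξ) h

/-- ★★ **THE CELL-BACKED EXTERIOR LEAF IS A `semOKHQ` FACT AT EVERY LEVEL**: the backing box's QUOTIENT fact `hN`, the tube-radius exterior certificate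
and the integer tube containment certify the leaf box on the quotient — near configurations by the cell (positivity, `‖ξ‖ ≤ 1/4` and the sector
hypotheses are forwarded unchanged: they concern `(U, ξ)`, not the box), far ones by ray domination. [formal bookkeeping + folklore chaining] -/
theorem semOKHQ_of_cellBacked {μ : ℤ} {J : Fin 3 → Fin 3 × Fin 3 → ℤ} {cC wC cH wH : Bx} {ch : List (Bx × Bx × (Fin 3 → Fin 3 → ℤ) × ℤ)}
    {lmin r : ℤ} {cN wN c w : Bx} (hN : semOKHQ μ cN wN = true) (h3 : exteriorOK3 J cC wC cH wH ch lmin r c w = true)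
    (ht : tubeBoxOK J cC wC r cN wN c w = true) : semOKHQ μ c w = true := by
  refine semOKHQ_of_forall fun U ξ hsa hpos hU hξn hcoord hb hab => ?_
  obtain ⟨hbox, hξ⟩ := (inHcpBox_iff c w U ξ).1 hcoord
  by_cases hfar : (r : ℝ) / SC ≤ ‖U (ξ - affShuf J cC U)‖
  · exact exteriorOK3_sound_farQ h3 U ξ hsa hU hbox hξ hfar
  · simp only [tubeBoxOK, Bool.and_eq_true, decide_eq_true_eq] at ht
    obtain ⟨⟨hUC, hUN⟩, htube⟩ := ht
    have hboxC := hbox_of_sameU hUC hbox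
    have hboxN := hbox_of_sameU hUN hbox
    have hξ₀J : ∀ m : Fin 3, |affShuf J cC U m - (cC (Sum.inr m) : ℝ) / SC| ≤ (jw J wC m : ℝ) / SC :=
      fun m => abs_affShuf_sub_le (J := J) (w := wC) U hboxC m
    have hξN := xi_mem_of_near hU hξ₀J (not_le.1 hfar) htube
    exact semOKHQ_forall hN U ξ hsa hpos hU hξn ((inHcpBox_iff cN wN U ξ).2 ⟨hboxN, hξN⟩) hb hab

/-- Soundness of the LISTED cell-backed leaf `cellBackedAt L n e` (Boolean of record) against a list of QUOTIENT facts. [formal bookkeeping] -/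
theorem cellBackedAt_soundQ {μ : ℤ} (L : List (Bx × Bx)) (hL : ∀ b ∈ L, semOKHQ μ b.1 b.2 = true) (n : ℕ) (e : ExtLeafData) (c w : Bx)
    (h : cellBackedAt L n e c w = true) : semOKHQ μ c w = true := by
  unfold cellBackedAt at h
  split at h
  · rename_i b hb
    simp only [Bool.and_eq_true] at h
    exact semOKHQ_of_cellBacked (hL b (List.mem_of_getElem? hb)) h.2 h.1
  · exact absurd h Bool.false_ne_true

/-! ## §3. The quotient column (R4) -/

/-- Cut glue in `(k, u)` form for the quotient currency. [formal bookkeeping] -/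
theorem semOKHQ_cut {μ : ℤ} (k : (Fin 3 × Fin 3) ⊕ Fin 3) (u : ℤ) (c w : (Fin 3 × Fin 3) ⊕ Fin 3 → ℤ)
    (hl : semOKHQ μ (Function.update c k (c k - w k + u)) (Function.update w k u) = true)
    (hr : semOKHQ μ (Function.update c k (c k + u)) (Function.update w k (w k - u)) = true) : semOKHQ μ c w = true :=
  semOKHQ_of_cut k (a := c k - w k + u) (b := u) (a' := c k + u) (b' := w k - u) (by ring) (by ring) (by ring) rfl rfl rfl rfl hl hr

/-- ★ **THE SIGN-FREE KERNEL PRUNE LEAF of the quotient**: `sectorOut ∨ ballOut ∨ forceMenuC` — the two VACUOUS prunes of the fundamental domain and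
the centred force/exempt menu of record WITHOUT its `xiBallOK` guard (the currency supplies `‖ξ‖ ≤ 1/4`) and without the signed quick table. Computable. -/
def kernLeafQ (c w : Bx) : Bool := sectorOut c w || ballOut c w || forceMenuC c w

/-- ★ Soundness: a box accepted by `kernLeafQ` is a `semOKHQ` fact at every level. [folklore chaining: `forceOutC0_sound` per menu direction, with the
quotient's own `‖ξ‖ ≤ 1/4`; the prunes by node §4] -/
theorem semOKHQ_of_kernLeafQ {μ : ℤ} {c w : Bx} (h : kernLeafQ c w = true) : semOKHQ μ c w = true := by
  simp only [kernLeafQ, Bool.or_eq_true] at h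
  rcases h with (h | h) | h
  · exact semOKHQ_of_sectorOut h
  · exact semOKHQ_of_ballOut h
  · exact semOKHQ_of_sound (μ := μ) (fun c w => forceMenuC c w)
      (fun c w hv U ξ _ _ hU hξn hbox hξ _ _ => by
        refine Or.inl ?_
        simp only [forceMenuC, Bool.or_eq_true] at hv
        rcases hv with ((((((h | h) | h) | h) | h) | h) | h) | h <;> exact forceOutC0_sound h U ξ hU hξn hbox hξ) h

/-- ★ **THE FIVE-KIND QUOTIENT COLUMN LEAF MENU**: `inl i` = containment in the listed QUOTIENT-certified cell `L[i]`; `inr (inl ())` = the sign-free KERNEL prune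
leaf `kernLeafQ` (`sectorOut ∨ ballOut ∨ forceMenuC`: outside the sector `Σ`, outside the ball `‖ξ‖ ≤ 1/4`, or force/exempt-pruned); `exteriorOK2`;
`annulusOK2`; `(n, e)` = cell-backed exterior leaf backed by `L[n]`.  Computable; every leaf Boolean is the tree's. -/
def colLeaf5Q (L : List (Bx × Bx)) : ℕ ⊕ (Unit ⊕ (ExtLeafData ⊕ (AnnLeafData ⊕ (ℕ × ExtLeafData)))) → Bx → Bx → Bool
  | .inl i, c, w => coveredAt L i c w
  | .inr (.inl _), c, w => kernLeafQ c w
  | .inr (.inr (.inl e)), c, w => exteriorOK2 e.J e.cC e.wC e.cH e.wH e.ch e.lmin e.g e.i c w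
  | .inr (.inr (.inr (.inl a))), c, w => annulusOK2 a.J a.cC a.wC a.cH a.wH a.ch a.ll a.den a.na a.nb a.g a.i c w
  | .inr (.inr (.inr (.inr ne))), c, w => cellBackedAt L ne.1 ne.2 c w

/-- ★★ **THE QUOTIENT MENU FOLD**: a cut tree over `colLeaf5Q L` accepted on a box makes it a `semOKHQ` fact at level `μ`, given the listed facts at `μ`.
[formal bookkeeping: `cutOK_sound` with `semOKHQ_cut`] -/
theorem semOKHQ_of_cutOK_colLeaf5Q {μ : ℤ} (L : List (Bx × Bx)) (hL : ∀ b ∈ L, semOKHQ μ b.1 b.2 = true) :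
    ∀ (t : CutTree ((Fin 3 × Fin 3) ⊕ Fin 3) (ℕ ⊕ (Unit ⊕ (ExtLeafData ⊕ (AnnLeafData ⊕ (ℕ × ExtLeafData)))))) (c w : Bx),
      cutOK (colLeaf5Q L) t c w = true → semOKHQ μ c w = true :=
  cutOK_sound (semOKHQ μ) (colLeaf5Q L) (fun a c w h => by
    rcases a with i | u | e | a | ne
    · exact coveredAt_sound (semOKHQ μ) (fun _ _ _ _ hc h => semOKHQ_anti_box hc h) L hL i c w h
    · exact semOKHQ_of_kernLeafQ h
    · exact semOKHQ_of_exteriorOK2 h μ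
    · exact semOKHQ_of_annulusOK2 h μ
    · exact cellBackedAt_soundQ L hL ne.1 ne.2 c w h) (fun k u c w hl hr => semOKHQ_cut k u c w hl hr)

/-- ★★★ **THE hcp QUARTER-ROOT FACT FROM A QUOTIENT COLUMN MANIFEST**: the listed quotient facts at level `μ` (sheet cells via file B's
`semOKHQ_of_A2QSQ`, E-cells, converted signed facts via node §5) and ONE accepted cut tree over the five-kind menu on the quarter root box
`rootCHQ/rootWHQ` (node §6) give `semOKHQ μ rootCHQ rootWHQ`. [formal bookkeeping] -/
theorem semOKHQ_root_of_colManifest5Q {μ : ℤ} (L : List (Bx × Bx)) (hL : ∀ b ∈ L, semOKHQ μ b.1 b.2 = true)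
    (t : CutTree ((Fin 3 × Fin 3) ⊕ Fin 3) (ℕ ⊕ (Unit ⊕ (ExtLeafData ⊕ (AnnLeafData ⊕ (ℕ × ExtLeafData))))))
    (h : cutOK (colLeaf5Q L) t rootCHQ rootWHQ = true) : semOKHQ μ rootCHQ rootWHQ = true :=
  semOKHQ_of_cutOK_colLeaf5Q L hL t rootCHQ rootWHQ h

/-- ★★★ **`HomFloor m` FROM THE fcc TREE OF RECORD AND A QUOTIENT COLUMN MANIFEST ON THE QUARTER ROOT** (node §6 consumer; `m = 1/625` at the level of
record). [formal bookkeeping] -/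
theorem homFloor_of_entryTree6RBKP4_colManifest5Q {m : ℝ} {μ : ℤ} (hμ : 2 * (m + (-(7175 / 10000) + 3 / 400)) * SC ≤ μ)
    (hF : ∃ t : CertTree (Fin 3 × Fin 3), treeOK (entryLeafOK6RBKP4 μ) t rootC rootW = true)
    (L : List (Bx × Bx)) (hL : ∀ b ∈ L, semOKHQ μ b.1 b.2 = true)
    (t : CutTree ((Fin 3 × Fin 3) ⊕ Fin 3) (ℕ ⊕ (Unit ⊕ (ExtLeafData ⊕ (AnnLeafData ⊕ (ℕ × ExtLeafData))))))
    (h : cutOK (colLeaf5Q L) t rootCHQ rootWHQ = true) : HomFloor m :=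
  homFloor_of_entryTree6RBKP4_semOKHQ hμ hF (semOKHQ_root_of_colManifest5Q L hL t h)

/-! ## §4. Kernel smoke tests (tiny trees; `SC = 2^48`) -/

/-- The box `ξ₁ ∈ [0.05, 0.15]` (otherwise the quarter root box) is accepted by the quotient column as ONE kernel prune leaf (it is outside `Σ`), and
also as a two-piece cut tree along `ξ₁` with a kernel prune leaf on each piece; the quarter root box itself is NOT a kernel prune leaf. -/
example :
    cutOK (colLeaf5Q []) (.leaf (.inr (.inl ()))) (Function.update rootCHQ (Sum.inr 1) 28147497671066) (Function.update rootWHQ (Sum.inr 1) 14073748835533) = true ∧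
      cutOK (colLeaf5Q []) (.cut (Sum.inr 1) 7036874417766 (.leaf (.inr (.inl ()))) (.leaf (.inr (.inl ()))))
        (Function.update rootCHQ (Sum.inr 1) 28147497671066) (Function.update rootWHQ (Sum.inr 1) 14073748835533) = true ∧
      kernLeafQ rootCHQ rootWHQ = false := by
  refine ⟨?_, ?_, ?_⟩ <;> decide +kernel

end Summit.AtomisticToContinuum.Crystallization.Theorems.FrustratedLawDichotomyStrainedPatchHomExteriorRay

end
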